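import Summits.Ventures.LatticeQCDFlow.Scoring.MadrasSokalRatioCLT
import Summits.Ventures.LatticeQCDFlow.Scoring.DeltaMethod
import Summits.Ventures.LatticeQCDFlow.Scoring.MadrasSokalWindow
import Summits.Ventures.LatticeQCDFlow.Exactness.NCMCGeneralSpaceGammaMethodStudentizedCLT

/-!
# The ASYMPTOTIC COVERAGE of the printed Madras–Sokal bar: the probability that `τ_W` lies within `z` printed bars of `τ̂_W` converges to `N(0, R/((4W+2) τ_W²))([−z, z])`

HONEST FRAMING: exact (Metropolis-corrected) sampling algorithms for lattice gauge theory;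
figures of merit are autocorrelation/cost numbers at stated couplings and volumes; no
continuum-physics claim.

Venture `LatticeQCDFlow` (cell pub-lqcd), sub-topic `Scoring`; FANOUT row 16 (`su2-base`), GEN-7.
NEW WORK of the cell over `Scoring/MadrasSokalRatioCLT` (the `τ̂_W` CLT), row 4's `Scoring/DeltaMethod`
(Slutsky pieces), row 11's `Scoring/MadrasSokalWindow` (`msDTau`, scorer B's printed bar) and row 13's
`Exactness/NCMCGeneralSpace{IntervalCoverage, GammaMethodStudentizedCLT}` (the plug-in coverage lemma,
Gaussian interval-mass monotonicity); nothing is cited as a fact.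

A file of the LAW-OF-THE-ERROR packet — what the law says about acceptance (d) 'errors on τ_int ≤ 15 %'.
Row 16 reads its `τ_int` with the PRINTED bar `δτ_B = τ̂ √((4W+2)/N)`; the operational meaning of a bar
is the coverage probability of `τ̂ ± z δτ_B`.  Here: under the block-factor model that probability has a
LIMIT, the centred Gaussian mass of `[−z, z]` at variance `R/((4W+2) τ_W²)` with `R = ℓᵀ Σ ℓ` the CLT
variance of `τ̂_W` (GEN-6's `R(W)` in the Wick model) — nominal `N(0,1)` coverage exactly when
`R = (4W+2) τ_W²`, over-coverage when `R < (4W+2) τ_W²`.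

## Contents

* **`tendstoInMeasure_tauIntWindow`** — consistency `τ̂_W(N) → τ_W` in probability (from the CLT).
* `msScale W τ = (|τ| √(4W+2))⁻¹` (studentising factor), `continuousAt_msScale`, `measurable_msScale`,
  `msScale_sq`; **`abs_mul_msScale_le_iff`** — for `τ̂ ≠ 0`, `N > 0`:
  `|√N (τ̂ − τ_W) B(τ̂)| ≤ z ↔ |τ̂ − τ_W| ≤ z · msDTau |τ̂| W N` (the printed-bar event).
* **`tendsto_measure_printedBar`** — THE COVERAGE LIMIT: `P{|√N (τ̂_W − τ_W) B(τ̂_W)| ≤ z} →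
  gaussianReal 0 (B(τ_W)² R) (Icc (−z) z)`, `B(τ_W)² R = R/((4W+2) τ_W²)` (Slutsky with the consistency).
* **`nominal_le_printedBar_limit`** — if `R ≤ (4W+2) τ_W²` the limit is `≥ gaussianReal 0 1 (Icc (−z) z)`.

NOT CLAIMED: the data-chosen window; scorer A's Wolff bar (`δτ_A ≤ δτ_B`, row 11 `wolffDTau_le_msDTau`,
so its coverage limit is the analogous Gaussian mass at `N δτ_A²`-scaled variance — not restated); that
`R ≤ (4W+2) τ_W²` holds at a given finite `W` (GEN-6 proves `R(W) < (4W+2) τ_int²` eventually in `W` for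
`0 ≤ ρ ≤ 1` in the Wick model; `τ_W ≤ τ_int`); rates; any number about row 16's chains.
-/

noncomputable section

open MeasureTheory ProbabilityTheory Filter Finset WithLp Set
open scoped Topology NNReal RealInnerProductSpace

namespace Summit.Ventures.LatticeQCDFlow.Scoring

section Coverage

variable {Ω : Type*} [MeasurableSpace Ω] {P : Measure Ω} [IsProbabilityMeasure P]
variable {Ω' : Type*} [MeasurableSpace Ω'] {P' : Measure Ω'} [IsProbabilityMeasure P']
variable {S : Type*} [MeasurableSpace S] {ξ : ℕ → Ω → S} {m : ℕ} {F : (Fin (m + 1) → S) → ℝ}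

/-- **Consistency of the windowed estimator**: `τ̂_W(N) → τ_W` in probability (a corollary of its CLT). -/
theorem tendstoInMeasure_tauIntWindow (hξ : ∀ i, Measurable (ξ i)) (hind : iIndepFun ξ P)
    (hid : ∀ i, IdentDistrib (ξ i) (ξ 0) P P) (hF : Measurable F)
    (h4 : ∀ t, MemLp (fun ω => blockFactor F ξ 0 ω * blockFactor F ξ t ω) 2 P) (W : ℕ)
    (hσ : P[fun ω => blockFactor F ξ 0 ω * blockFactor F ξ 0 ω] ≠ 0)
    {Z : Ω' → EuclideanSpace ℝ (Fin (W + 1))} (hZm : AEMeasurable Z P')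
    (hZ : ∀ a : EuclideanSpace ℝ (Fin (W + 1)), HasLaw (fun ω' => ⟪a, Z ω'⟫) (gaussianReal 0
      (∑ s : Fin (W + 1), ∑ t : Fin (W + 1),
        a s * a t * lagProdACov (blockFactor F ξ) P (m + W) s t).toNNReal) P') :
    TendstoInMeasure P
      (fun (N : ℕ) ω => tauIntWindow (fun t => acovHat (blockFactor F ξ) N t ω
        / acovHat (blockFactor F ξ) N 0 ω) W) atTop
      (fun _ => tauIntWindow (fun t => P[fun ω => blockFactor F ξ 0 ω * blockFactor F ξ t ω]
        / P[fun ω => blockFactor F ξ 0 ω * blockFactor F ξ 0 ω]) W) :=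
  CardConsistency.tendstoInMeasure_of_tendstoInDistribution_scaled
    (Real.tendsto_sqrt_atTop.comp tendsto_natCast_atTop_atTop)
    (tendstoInDistribution_tauIntWindow hξ hind hid hF h4 W hσ hZm hZ)

/-- The studentising factor of the printed bar: `B = (|τ| √(4W+2))⁻¹`, continuous off `τ = 0`. [ours] -/
def msScale (W : ℕ) (τ : ℝ) : ℝ := (|τ| * Real.sqrt (4 * W + 2))⁻¹

/-- `msScale` is continuous at every `τ ≠ 0`. -/
theorem continuousAt_msScale (W : ℕ) {τ : ℝ} (hτ : τ ≠ 0) : ContinuousAt (msScale W) τ := by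
  unfold msScale
  refine ContinuousAt.inv₀ (by fun_prop) ?_
  exact mul_ne_zero (abs_ne_zero.2 hτ) (Real.sqrt_ne_zero'.2 (by positivity))

/-- `msScale` is measurable. -/
theorem measurable_msScale (W : ℕ) : Measurable (msScale W) := by
  unfold msScale; fun_prop

/-- **The printed-bar event.**  For `τ̂ ≠ 0` and `N > 0`:
`|√N (τ̂ − τ_W) · B(τ̂)| ≤ z ↔ |τ̂ − τ_W| ≤ z · |τ̂| √((4W+2)/N)` — the right side is 'the truth lies within
`z` printed bars `δτ_B = τ̂ √((4W+2)/N)` (`MadrasSokalWindow.msDTau`, scorer B) of the estimate'. -/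
theorem abs_mul_msScale_le_iff (W : ℕ) {τhat τW z : ℝ} (hτ : τhat ≠ 0) {N : ℕ} (hN : 0 < N) :
    |Real.sqrt N * (τhat - τW) * msScale W τhat| ≤ z
      ↔ |τhat - τW| ≤ z * msDTau |τhat| W N := by
  have hNr : (0 : ℝ) < N := Nat.cast_pos.2 hN
  have hs : 0 < Real.sqrt N := Real.sqrt_pos.2 hNr
  have hw : 0 < Real.sqrt (4 * W + 2) := Real.sqrt_pos.2 (by positivity)
  have hd : 0 < |τhat| * Real.sqrt (4 * W + 2) := mul_pos (abs_pos.2 hτ) hw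
  rw [msScale, msDTau, abs_mul, abs_mul, abs_inv, abs_of_pos hs, abs_of_pos hd,
    Real.sqrt_div' _ hNr.le, ← div_eq_mul_inv, div_le_iff₀ hd]
  rw [show z * (|τhat| * (Real.sqrt (4 * W + 2) / Real.sqrt N))
      = z * (|τhat| * Real.sqrt (4 * W + 2)) / Real.sqrt N by ring, le_div_iff₀ hs]
  ring_nf

/-- **THE ASYMPTOTIC COVERAGE OF THE PRINTED BAR.**  Block-factor process with square-integrable lag
products, `c(0) ≠ 0` and `τ_W ≠ 0`; `Z` the Gaussian limit of the autocovariance vector, `ℓ` the gradient,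
`R = ℓᵀ Σ ℓ` the CLT variance of `τ̂_W`.  Then for every `z > 0` the probability of the studentised event
`|√N (τ̂_W − τ_W) · B(τ̂_W)| ≤ z` — i.e. (off the null event `τ̂_W = 0`) of `|τ̂_W − τ_W| ≤ z δτ_B(N)` with
the PRINTED bar `δτ_B = τ̂_W √((4W+2)/N)` — converges to `N(0, R/((4W+2) τ_W²))([−z, z])`. -/
theorem tendsto_measure_printedBar (hξ : ∀ i, Measurable (ξ i)) (hind : iIndepFun ξ P)
    (hid : ∀ i, IdentDistrib (ξ i) (ξ 0) P P) (hF : Measurable F)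
    (h4 : ∀ t, MemLp (fun ω => blockFactor F ξ 0 ω * blockFactor F ξ t ω) 2 P) (W : ℕ)
    (hσ : P[fun ω => blockFactor F ξ 0 ω * blockFactor F ξ 0 ω] ≠ 0)
    (hτ : tauIntWindow (fun t => P[fun ω => blockFactor F ξ 0 ω * blockFactor F ξ t ω]
        / P[fun ω => blockFactor F ξ 0 ω * blockFactor F ξ 0 ω]) W ≠ 0)
    {Z : Ω' → EuclideanSpace ℝ (Fin (W + 1))} (hZm : AEMeasurable Z P')
    (hZ : ∀ a : EuclideanSpace ℝ (Fin (W + 1)), HasLaw (fun ω' => ⟪a, Z ω'⟫) (gaussianReal 0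
      (∑ s : Fin (W + 1), ∑ t : Fin (W + 1),
        a s * a t * lagProdACov (blockFactor F ξ) P (m + W) s t).toNNReal) P') {z : ℝ} (hz : 0 < z) :
    Tendsto (fun N : ℕ => P {ω | |Real.sqrt N
        * (tauIntWindow (fun t => acovHat (blockFactor F ξ) N t ω / acovHat (blockFactor F ξ) N 0 ω) W
          - tauIntWindow (fun t => P[fun ω => blockFactor F ξ 0 ω * blockFactor F ξ t ω]
              / P[fun ω => blockFactor F ξ 0 ω * blockFactor F ξ 0 ω]) W)
        * msScale W (tauIntWindow (fun t => acovHat (blockFactor F ξ) N t ω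
            / acovHat (blockFactor F ξ) N 0 ω) W)| ≤ z}) atTop
      (𝓝 (gaussianReal 0 (NNReal.mk (msScale W (tauIntWindow (fun t =>
          P[fun ω => blockFactor F ξ 0 ω * blockFactor F ξ t ω]
            / P[fun ω => blockFactor F ξ 0 ω * blockFactor F ξ 0 ω]) W) ^ 2) (sq_nonneg _)
        * (∑ s : Fin (W + 1), ∑ t : Fin (W + 1),
            tauHatGrad W (toLp 2 fun t : Fin (W + 1) =>
              P[fun ω => blockFactor F ξ 0 ω * blockFactor F ξ t ω]) s
            * tauHatGrad W (toLp 2 fun t : Fin (W + 1) =>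
              P[fun ω => blockFactor F ξ 0 ω * blockFactor F ξ t ω]) t
            * lagProdACov (blockFactor F ξ) P (m + W) s t).toNNReal) (Icc (-z) z))) := by
  have hclt := tendstoInDistribution_tauIntWindow hξ hind hid hF h4 W hσ hZm hZ
  have hlaw := hasLaw_inner_tauHatGrad hZ (toLp 2 fun t : Fin (W + 1) =>
    P[fun ω => blockFactor F ξ 0 ω * blockFactor F ξ t ω])
  have hcons := tendstoInMeasure_tauIntWindow hξ hind hid hF h4 W hσ hZm hZ
  have hB := CardConsistency.tendstoInMeasure_comp_continuousAt hcons (continuousAt_msScale W hτ)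
  have hBm : ∀ N : ℕ, Measurable fun ω => msScale W (tauIntWindow (fun t =>
      acovHat (blockFactor F ξ) N t ω / acovHat (blockFactor F ξ) N 0 ω) W) := by
    intro N
    refine (measurable_msScale W).comp ?_
    unfold tauIntWindow
    exact measurable_const.add (Finset.measurable_sum _ fun t _ =>
      (measurable_acovHat_blockFactor hξ hF N (t + 1)).div (measurable_acovHat_blockFactor hξ hF N 0))
  exact Exactness.GeneralNCMC.tendsto_measure_abs_mul_le_of_clt_of_tendstoInMeasure hBm hlaw hclt hB hz

/-- `B(τ)² = 1/((4W+2) τ²)`. -/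
theorem msScale_sq (W : ℕ) (τ : ℝ) : msScale W τ ^ 2 = ((4 * W + 2) * τ ^ 2)⁻¹ := by
  rw [msScale, inv_pow, mul_pow, sq_abs, Real.sq_sqrt (by positivity)]
  ring

/-- **Over-coverage criterion.**  If the CLT variance satisfies `R ≤ (4W+2) τ_W²` — the square of the
printed bar times `N`, at the windowed truth — then the limiting coverage of the printed `±z δτ_B`
interval is AT LEAST the nominal Gaussian mass `N(0,1)([−z, z])` (GEN-6: in the Wick model with
`0 ≤ ρ ≤ 1`, `R(W) < (4W+2) τ_int²` for all large `W`, `MadrasSokalRatioVariance.eventually_tauHatRatioAVar_lt_printed`;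
`τ_W ↑ τ_int`). -/
theorem nominal_le_printedBar_limit (W : ℕ) {R τW : ℝ} (hτ : τW ≠ 0) (hR0 : 0 ≤ R)
    (hR : R ≤ (4 * W + 2) * τW ^ 2) {z : ℝ} (hz : 0 ≤ z) :
    gaussianReal 0 1 (Icc (-z) z)
      ≤ gaussianReal 0 (NNReal.mk (msScale W τW ^ 2) (sq_nonneg _) * R.toNNReal) (Icc (-z) z) := by
  refine Exactness.GeneralNCMC.measure_Icc_gaussianReal_anti ?_ hz
  have hpos : 0 < (4 * (W : ℝ) + 2) * τW ^ 2 := by positivity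
  rw [← NNReal.coe_le_coe, NNReal.coe_mul, NNReal.coe_mk, Real.coe_toNNReal _ hR0, NNReal.coe_one,
    msScale_sq, inv_mul_eq_div, div_le_one hpos]
  exact hR

end Coverage

end Summit.Ventures.LatticeQCDFlow.Scoring

end
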